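import Mathlib
import HarnessLib
import Summits.HubbardSuperconductivity.HubbardSuperconductivity.Theorems.KLProgrammePerturbedFermiCurveTwoFrameTower

/-!
# Route `KLProgramme` — TWO polar level curves, order THREE (`|v‴ − u‴|` linear in the differences of the derivatives of the two level
# functions at the two curve points) + the multilinear difference lemmas order four needs (pointwise algebra; (E3a-MS), frame side)

Cell `gate-hubbard-kl`, seat hubbard-kl-k3c3-p3 (g3; row «implicit-function / monotonicity route»).  Continuation of
`…PerturbedFermiCurveTwoFrameTower` (p490050, orders 1–2) in the style of p476128's `abs_top_le_of_level_three/four`: the order-3 (five-term)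
and order-4 (fifteen-term) differentiated level identities of the two curves are subtracted term by term; every multilinear difference
`Ã_k[ṽ…] − A_k[v…]` is `≤ Δ_k·(sizes) + E_k·(one difference factor)·(sizes)`, and the top radial coefficients are compared by
`abs_sub_of_two_solves`.  For the ENGINE child's two-leg stubs (stmt-HubbardSuperconductivity-19855), clause (E3a-MS) (HOME/hubbard-kl-k3c3-p3/MS-CUT.md).

* §1 `mul_norm₃/₄_le`, `abs_apply{₁,₂,₃,₄}_sub_le'`: multilinear evaluation differences with REAL bounds
  (`Δ·X·Y·Z + E·(dX·Y·Z + X·dY·Z + X·Y·dZ)`, `Δ·X⁴ + 4E·dX·X³`, …) — order four's term bounds included.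
* §2 `abs_top_sub_top_le_of_level_three`: the abstract two-solve bound for the five-term order-3 identities.
* §3 `abs_deriv_three_sub_le_of_polar_levels`: for `C⁴` level functions `e, e′` with polar curves `u•dir`, `v•dir`: `|v‴ − u‴|` in terms
  of `W₀, W₁, W₂` (lower-order differences), `Δ₁, Δ₂, Δ₃` (derivative differences at the two points), `E₁, E₂, E₃` (sizes of `e`'s
  derivatives at `p`), `U₀, R₁, R₂, R₃` (common radius-tower bounds), `ρ₀` (transversality of the second curve).  Order four
  (fifteen terms) follows in a companion file with the same two-solve pattern; the band instantiation (`Δ_j ≤ (4+κ_{j+1})W₀ + ‖Dʲ(δ′−δ)‖`)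
  extends `…TwoFrameBand`.

Everything is PROVED; no definitions; nothing about the Hubbard model.  References: BGM 2006 §2.4 Lemma 2.1 (2.40)
[cite: BenfattoGiulianiMastropietro2006]; FST IV (CPAM 53 (2000) 1350) Thm 2.
-/

noncomputable section

namespace Summit.HubbardSuperconductivity.HubbardSuperconductivity.Theorems.PerturbedFermiCurve

set_option linter.dupNamespace false -- summit = problem name (single-conjunct summit), D-0017
set_option maxSynthPendingDepth 3 -- nested operator-norm instances (third/fourth Fréchet derivatives)

open Real Set
open Literature.MathematicalPhysics.QuantumLattice Literature.MathematicalPhysics.QuantumLattice.BandSectorCounting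

/-! ## §1 Multilinear evaluation differences with real bounds -/

section Algebra

variable {V : Type*} [NormedAddCommGroup V] [NormedSpace ℝ V]

omit [NormedSpace ℝ V] in
/-- Products of norm bounds, three factors. [folklore] -/
theorem mul_norm₃_le {E X Y Z : ℝ} (hE : 0 ≤ E) {a b c : V} (ha : ‖a‖ ≤ X) (hb : ‖b‖ ≤ Y) (hc : ‖c‖ ≤ Z) :
    E * ‖a‖ * ‖b‖ * ‖c‖ ≤ E * X * Y * Z := by
  have hX : 0 ≤ X := (norm_nonneg _).trans ha
  have hY : 0 ≤ Y := (norm_nonneg _).trans hb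
  exact mul_le_mul (mul_le_mul (mul_le_mul_of_nonneg_left ha hE) hb (norm_nonneg _) (mul_nonneg hE hX)) hc (norm_nonneg _)
    (mul_nonneg (mul_nonneg hE hX) hY)

omit [NormedSpace ℝ V] in
/-- Products of norm bounds, four factors. [folklore] -/
theorem mul_norm₄_le {E X Y Z W : ℝ} (hE : 0 ≤ E) {a b c d : V} (ha : ‖a‖ ≤ X) (hb : ‖b‖ ≤ Y) (hc : ‖c‖ ≤ Z) (hd : ‖d‖ ≤ W) :
    E * ‖a‖ * ‖b‖ * ‖c‖ * ‖d‖ ≤ E * X * Y * Z * W := by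
  have hX : 0 ≤ X := (norm_nonneg _).trans ha
  have hY : 0 ≤ Y := (norm_nonneg _).trans hb
  have hZ : 0 ≤ Z := (norm_nonneg _).trans hc
  exact mul_le_mul (mul_norm₃_le hE ha hb hc) hd (norm_nonneg _) (mul_nonneg (mul_nonneg (mul_nonneg hE hX) hY) hZ)

/-- Linear: `‖Ã − A‖ ≤ Δ`, `‖A‖ ≤ E`, `‖x̃‖ ≤ X`, `‖x̃ − x‖ ≤ dX` ⟹ `|Ã x̃ − A x| ≤ Δ·X + E·dX`. [folklore] -/
theorem abs_apply_sub_le' {A Ã : V →L[ℝ] ℝ} {x x' : V} {Δ E X dX : ℝ} (hΔ : ‖Ã - A‖ ≤ Δ) (hE : ‖A‖ ≤ E)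
    (hX : ‖x'‖ ≤ X) (hdX : ‖x' - x‖ ≤ dX) : |Ã x' - A x| ≤ Δ * X + E * dX := by
  have hΔ0 : 0 ≤ Δ := (norm_nonneg _).trans hΔ
  have hE0 : 0 ≤ E := (norm_nonneg _).trans hE
  refine (abs_apply_sub_apply_le A Ã x x').trans (add_le_add ?_ ?_)
  · exact mul_le_mul hΔ hX (norm_nonneg _) hΔ0
  · exact mul_le_mul hE hdX (norm_nonneg _) hE0

/-- Bilinear: `|Ã x̃ ỹ − A x y| ≤ Δ·X·Y + E·(dX·Y + X·dY)` (`‖x̃‖, ‖x‖ ≤ X`, `‖ỹ‖ ≤ Y`). [folklore] -/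
theorem abs_apply₂_sub_le' {A Ã : V →L[ℝ] V →L[ℝ] ℝ} {x x' y y' : V} {Δ E X Y dX dY : ℝ} (hΔ : ‖Ã - A‖ ≤ Δ) (hE : ‖A‖ ≤ E)
    (hX : ‖x‖ ≤ X) (hX' : ‖x'‖ ≤ X) (hY' : ‖y'‖ ≤ Y) (hdX : ‖x' - x‖ ≤ dX) (hdY : ‖y' - y‖ ≤ dY) :
    |Ã x' y' - A x y| ≤ Δ * X * Y + E * (dX * Y + X * dY) := by
  have hΔ0 : 0 ≤ Δ := (norm_nonneg _).trans hΔ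
  have hE0 : 0 ≤ E := (norm_nonneg _).trans hE
  have hX0 : 0 ≤ X := (norm_nonneg _).trans hX
  refine (abs_apply₂_sub_apply₂_le A Ã x x' y y').trans (add_le_add ?_ ?_)
  · exact mul_le_mul (mul_le_mul hΔ hX' (norm_nonneg _) hΔ0) hY' (norm_nonneg _) (mul_nonneg hΔ0 hX0)
  · refine mul_le_mul hE (add_le_add ?_ ?_) (by positivity) hE0
    · exact mul_le_mul hdX hY' (norm_nonneg _) ((norm_nonneg _).trans hdX)
    · exact mul_le_mul hX hdY (norm_nonneg _) hX0

/-- Trilinear difference identity. [folklore] -/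
theorem apply₃_sub_apply₃_eq (A Ã : V →L[ℝ] V →L[ℝ] V →L[ℝ] ℝ) (x x' y y' z z' : V) :
    Ã x' y' z' - A x y z = (Ã - A) x' y' z' + A (x' - x) y' z' + A x (y' - y) z' + A x y (z' - z) := by
  simp only [sub_apply, map_sub]; ring

/-- Trilinear: `|Ã x̃ ỹ z̃ − A x y z| ≤ Δ·X·Y·Z + E·(dX·Y·Z + X·dY·Z + X·Y·dZ)`. [folklore] -/
theorem abs_apply₃_sub_le' {A Ã : V →L[ℝ] V →L[ℝ] V →L[ℝ] ℝ} {x x' y y' z z' : V} {Δ E X Y Z dX dY dZ : ℝ}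
    (hΔ : ‖Ã - A‖ ≤ Δ) (hE : ‖A‖ ≤ E) (hX : ‖x‖ ≤ X) (hX' : ‖x'‖ ≤ X) (hY : ‖y‖ ≤ Y) (hY' : ‖y'‖ ≤ Y) (hZ' : ‖z'‖ ≤ Z)
    (hdX : ‖x' - x‖ ≤ dX) (hdY : ‖y' - y‖ ≤ dY) (hdZ : ‖z' - z‖ ≤ dZ) :
    |Ã x' y' z' - A x y z| ≤ Δ * X * Y * Z + E * (dX * Y * Z + X * dY * Z + X * Y * dZ) := by
  have hΔ0 : 0 ≤ Δ := (Ã - A).opNorm_nonneg.trans hΔ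
  have hE0 : 0 ≤ E := A.opNorm_nonneg.trans hE
  have hX0 : 0 ≤ X := (norm_nonneg _).trans hX
  have hY0 : 0 ≤ Y := (norm_nonneg _).trans hY
  have hZ0 : 0 ≤ Z := (norm_nonneg _).trans hZ'
  rw [apply₃_sub_apply₃_eq]
  have t1 : |(Ã - A) x' y' z'| ≤ Δ * X * Y * Z :=
    (abs_apply₃_le_of_opNorm_le _ hΔ _ _ _).trans (mul_norm₃_le hΔ0 hX' hY' hZ')
  have t2 : |A (x' - x) y' z'| ≤ E * dX * Y * Z :=
    (abs_apply₃_le_of_opNorm_le _ hE _ _ _).trans (mul_norm₃_le hE0 hdX hY' hZ')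
  have t3 : |A x (y' - y) z'| ≤ E * X * dY * Z :=
    (abs_apply₃_le_of_opNorm_le _ hE _ _ _).trans (mul_norm₃_le hE0 hX hdY hZ')
  have t4 : |A x y (z' - z)| ≤ E * X * Y * dZ :=
    (abs_apply₃_le_of_opNorm_le _ hE _ _ _).trans (mul_norm₃_le hE0 hX hY hdZ)
  have := abs_add_le_add (abs_add_le_add (abs_add_le_add t1 t2) t3) t4
  refine this.trans (le_of_eq ?_); ring

/-- Quadrilinear difference identity. [folklore] -/
theorem apply₄_sub_apply₄_eq (A Ã : V →L[ℝ] V →L[ℝ] V →L[ℝ] V →L[ℝ] ℝ) (x x' y y' z z' w w' : V) :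
    Ã x' y' z' w' - A x y z w =
      (Ã - A) x' y' z' w' + A (x' - x) y' z' w' + A x (y' - y) z' w' + A x y (z' - z) w' + A x y z (w' - w) := by
  simp only [sub_apply, map_sub]; ring

/-- Quadrilinear, equal arguments: `|Ã x̃ x̃ x̃ x̃ − A x x x x| ≤ Δ·X⁴ + 4·E·dX·X³`. [folklore] -/
theorem abs_apply₄_sub_le' {A Ã : V →L[ℝ] V →L[ℝ] V →L[ℝ] V →L[ℝ] ℝ} {x x' : V} {Δ E X dX : ℝ}
    (hΔ : ‖Ã - A‖ ≤ Δ) (hE : ‖A‖ ≤ E) (hX : ‖x‖ ≤ X) (hX' : ‖x'‖ ≤ X) (hdX : ‖x' - x‖ ≤ dX) :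
    |Ã x' x' x' x' - A x x x x| ≤ Δ * X ^ 4 + 4 * E * dX * X ^ 3 := by
  have hΔ0 : 0 ≤ Δ := (Ã - A).opNorm_nonneg.trans hΔ
  have hE0 : 0 ≤ E := A.opNorm_nonneg.trans hE
  have hX0 : 0 ≤ X := (norm_nonneg _).trans hX
  rw [apply₄_sub_apply₄_eq]
  have t1 : |(Ã - A) x' x' x' x'| ≤ Δ * X * X * X * X :=
    (abs_apply₄_le_of_opNorm_le _ hΔ _ _ _ _).trans (mul_norm₄_le hΔ0 hX' hX' hX' hX')
  have t2 : |A (x' - x) x' x' x'| ≤ E * dX * X * X * X :=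
    (abs_apply₄_le_of_opNorm_le _ hE _ _ _ _).trans (mul_norm₄_le hE0 hdX hX' hX' hX')
  have t3 : |A x (x' - x) x' x'| ≤ E * X * dX * X * X :=
    (abs_apply₄_le_of_opNorm_le _ hE _ _ _ _).trans (mul_norm₄_le hE0 hX hdX hX' hX')
  have t4 : |A x x (x' - x) x'| ≤ E * X * X * dX * X :=
    (abs_apply₄_le_of_opNorm_le _ hE _ _ _ _).trans (mul_norm₄_le hE0 hX hX hdX hX')
  have t5 : |A x x x (x' - x)| ≤ E * X * X * X * dX :=
    (abs_apply₄_le_of_opNorm_le _ hE _ _ _ _).trans (mul_norm₄_le hE0 hX hX hX hdX)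
  have := abs_add_le_add (abs_add_le_add (abs_add_le_add (abs_add_le_add t1 t2) t3) t4) t5
  refine this.trans (le_of_eq ?_); ring

/-! ## §2 Abstract two-solve bounds for the order-3 and order-4 identities -/

/-- **Order 3, two solves.**  The five-term identities of both curves (shape of `level_chain_three`), `v₃ = s•d + r`, `ṽ₃ = s̃•d + r̃`,
`Ã₁ d ≥ ρ₀ > 0`, `‖d‖ ≤ 1`; sizes `‖A_k‖ ≤ E_k`, differences `‖Ã_k − A_k‖ ≤ Δ_k`; `‖v₁‖, ‖ṽ₁‖ ≤ K₁`, `‖v₂‖, ‖ṽ₂‖ ≤ K₂`, `‖ṽ₁ − v₁‖ ≤ δ₁`,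
`‖ṽ₂ − v₂‖ ≤ δ₂`, `‖r̃‖ ≤ L`, `‖r̃ − r‖ ≤ dL`, `|s| ≤ S`:
`|s̃ − s| ≤ (Δ₃K₁³ + 3E₃δ₁K₁² + 3(Δ₂K₁K₂ + E₂(δ₂K₁ + K₂δ₁)) + Δ₁L + E₁dL + S·Δ₁)/ρ₀`. [folklore] -/
theorem abs_top_sub_top_le_of_level_three {A₁ Ã₁ : V →L[ℝ] ℝ} {A₂ Ã₂ : V →L[ℝ] V →L[ℝ] ℝ} {A₃ Ã₃ : V →L[ℝ] V →L[ℝ] V →L[ℝ] ℝ}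
    {v₁ v₂ v₃ w₁ w₂ w₃ d r r' : V} {s s' ρ₀ E₁ E₂ E₃ Δ₁ Δ₂ Δ₃ K₁ K₂ δ₁ δ₂ L dL S : ℝ}
    (hid : A₃ v₁ v₁ v₁ + A₂ v₂ v₁ + A₂ v₁ v₂ + (A₂ v₁ v₂ + A₁ v₃) = 0)
    (hid' : Ã₃ w₁ w₁ w₁ + Ã₂ w₂ w₁ + Ã₂ w₁ w₂ + (Ã₂ w₁ w₂ + Ã₁ w₃) = 0)
    (hv : v₃ = s • d + r) (hw : w₃ = s' • d + r') (hρ' : ρ₀ ≤ Ã₁ d) (hρ0 : 0 < ρ₀) (hd : ‖d‖ ≤ 1)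
    (hE₁ : ‖A₁‖ ≤ E₁) (hE₂ : ‖A₂‖ ≤ E₂) (hE₃ : ‖A₃‖ ≤ E₃)
    (hΔ₁ : ‖Ã₁ - A₁‖ ≤ Δ₁) (hΔ₂ : ‖Ã₂ - A₂‖ ≤ Δ₂) (hΔ₃ : ‖Ã₃ - A₃‖ ≤ Δ₃)
    (hK₁ : ‖v₁‖ ≤ K₁) (hK₁' : ‖w₁‖ ≤ K₁) (hK₂ : ‖v₂‖ ≤ K₂) (hK₂' : ‖w₂‖ ≤ K₂)
    (hδ₁ : ‖w₁ - v₁‖ ≤ δ₁) (hδ₂ : ‖w₂ - v₂‖ ≤ δ₂) (hL : ‖r'‖ ≤ L) (hdL : ‖r' - r‖ ≤ dL) (hS : |s| ≤ S) :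
    |s' - s| ≤ (Δ₃ * K₁ ^ 3 + 3 * E₃ * δ₁ * K₁ ^ 2 + 3 * (Δ₂ * K₁ * K₂ + E₂ * (δ₂ * K₁ + K₂ * δ₁)) + Δ₁ * L + E₁ * dL +
      S * Δ₁) / ρ₀ := by
  have hΔ10 : 0 ≤ Δ₁ := (norm_nonneg _).trans hΔ₁
  -- the two solved forms
  rw [hv, map_add, map_smul, smul_eq_mul] at hid
  rw [hw, map_add, map_smul, smul_eq_mul] at hid'
  have h : s * A₁ d = -(A₃ v₁ v₁ v₁ + A₂ v₂ v₁ + A₂ v₁ v₂ + A₂ v₁ v₂ + A₁ r) := by linarith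
  have h' : s' * Ã₁ d = -(Ã₃ w₁ w₁ w₁ + Ã₂ w₂ w₁ + Ã₂ w₁ w₂ + Ã₂ w₁ w₂ + Ã₁ r') := by linarith
  have hsol := abs_sub_of_two_solves h h' hρ' hρ0
  -- term differences
  have t3 : |Ã₃ w₁ w₁ w₁ - A₃ v₁ v₁ v₁| ≤ Δ₃ * K₁ * K₁ * K₁ + E₃ * (δ₁ * K₁ * K₁ + K₁ * δ₁ * K₁ + K₁ * K₁ * δ₁) :=
    abs_apply₃_sub_le' hΔ₃ hE₃ hK₁ hK₁' hK₁ hK₁' hK₁' hδ₁ hδ₁ hδ₁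
  have t21 : |Ã₂ w₂ w₁ - A₂ v₂ v₁| ≤ Δ₂ * K₂ * K₁ + E₂ * (δ₂ * K₁ + K₂ * δ₁) :=
    abs_apply₂_sub_le' hΔ₂ hE₂ hK₂ hK₂' hK₁' hδ₂ hδ₁
  have t12 : |Ã₂ w₁ w₂ - A₂ v₁ v₂| ≤ Δ₂ * K₁ * K₂ + E₂ * (δ₁ * K₂ + K₁ * δ₂) :=
    abs_apply₂_sub_le' hΔ₂ hE₂ hK₁ hK₁' hK₂' hδ₁ hδ₂
  have t1 : |Ã₁ r' - A₁ r| ≤ Δ₁ * L + E₁ * dL := abs_apply_sub_le' hΔ₁ hE₁ hL hdL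
  have hT : |Ã₃ w₁ w₁ w₁ + Ã₂ w₂ w₁ + Ã₂ w₁ w₂ + Ã₂ w₁ w₂ + Ã₁ r' - (A₃ v₁ v₁ v₁ + A₂ v₂ v₁ + A₂ v₁ v₂ + A₂ v₁ v₂ + A₁ r)| ≤
      (Δ₃ * K₁ * K₁ * K₁ + E₃ * (δ₁ * K₁ * K₁ + K₁ * δ₁ * K₁ + K₁ * K₁ * δ₁)) + (Δ₂ * K₂ * K₁ + E₂ * (δ₂ * K₁ + K₂ * δ₁)) +
        (Δ₂ * K₁ * K₂ + E₂ * (δ₁ * K₂ + K₁ * δ₂)) + (Δ₂ * K₁ * K₂ + E₂ * (δ₁ * K₂ + K₁ * δ₂)) + (Δ₁ * L + E₁ * dL) := by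
    have e : Ã₃ w₁ w₁ w₁ + Ã₂ w₂ w₁ + Ã₂ w₁ w₂ + Ã₂ w₁ w₂ + Ã₁ r' - (A₃ v₁ v₁ v₁ + A₂ v₂ v₁ + A₂ v₁ v₂ + A₂ v₁ v₂ + A₁ r) =
        (Ã₃ w₁ w₁ w₁ - A₃ v₁ v₁ v₁) + (Ã₂ w₂ w₁ - A₂ v₂ v₁) + (Ã₂ w₁ w₂ - A₂ v₁ v₂) + (Ã₂ w₁ w₂ - A₂ v₁ v₂) + (Ã₁ r' - A₁ r) := by
      ring
    rw [e]
    exact abs_add_le_add (abs_add_le_add (abs_add_le_add (abs_add_le_add t3 t21) t12) t12) t1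
  have hdd : |Ã₁ d - A₁ d| ≤ Δ₁ := by
    rw [← sub_apply]; exact (abs_apply_le_of_opNorm_le _ hΔ₁ _).trans (mul_le_of_le_one_right hΔ10 hd)
  have hs : |s| * |Ã₁ d - A₁ d| ≤ S * Δ₁ := mul_le_mul hS hdd (abs_nonneg _) ((abs_nonneg _).trans hS)
  refine hsol.trans (div_le_div_of_nonneg_right ?_ hρ0.le)
  have e2 : Δ₃ * K₁ * K₁ * K₁ + E₃ * (δ₁ * K₁ * K₁ + K₁ * δ₁ * K₁ + K₁ * K₁ * δ₁) = Δ₃ * K₁ ^ 3 + 3 * E₃ * δ₁ * K₁ ^ 2 := by ring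
  nlinarith [hT, hs, e2]

end Algebra

/-! ## §3 Two polar level curves: order three -/

section TwoPolar

variable {e e' : (Fin 2 → ℝ) → ℝ} (he : ContDiff ℝ 4 e) (he' : ContDiff ℝ 4 e') {u v : ℝ → ℝ} (hu : ContDiff ℝ 4 u)
  (hv : ContDiff ℝ 4 v) {c c' : ℝ} (hlev : ∀ ϑ, e (u ϑ • dir ϑ) = c) (hlev' : ∀ ϑ, e' (v ϑ • dir ϑ) = c')
include he he' hu hv hlev hlev'

/-- **Order 3, two curves.**  At `θ` (`p = u θ•dir θ`, `ṽ = v θ•dir θ`): transversality of the second curve `De′(ṽ)[dir θ] ≥ ρ₀ > 0`;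
sizes `‖Dᵏe(p)‖ ≤ E_k` (k ≤ 3); differences `‖Dᵏe′(ṽ) − Dᵏe(p)‖ ≤ Δ_k` (k ≤ 3); common tower bounds `|u|,|v| ≤ U₀`, `|u′|,|v′| ≤ R₁`,
`|u″|,|v″| ≤ R₂`, `|u‴| ≤ R₃`; lower differences `|v − u| ≤ W₀`, `|v′ − u′| ≤ W₁`, `|v″ − u″| ≤ W₂`; with `K₁ = R₁ + U₀`,
`K₂ = R₂ + 2R₁ + U₀`, `δ₁ = W₁ + W₀`, `δ₂ = W₂ + 2W₁ + W₀`: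
`|v‴ − u‴| ≤ (Δ₃K₁³ + 3E₃δ₁K₁² + 3(Δ₂K₁K₂ + E₂(δ₂K₁ + K₂δ₁)) + Δ₁(3R₂ + 3R₁ + U₀) + E₁(3W₂ + 3W₁ + W₀) + R₃Δ₁)/ρ₀`.
[cite: BenfattoGiulianiMastropietro2006, §2.4 Lemma 2.1 (2.40)] -/
theorem abs_deriv_three_sub_le_of_polar_levels {θ ρ₀ E₁ E₂ E₃ Δ₁ Δ₂ Δ₃ U₀ R₁ R₂ R₃ W₀ W₁ W₂ : ℝ} (hρ0 : 0 < ρ₀)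
    (hρ' : ρ₀ ≤ fderiv ℝ e' (v θ • dir θ) (dir θ))
    (hE₁ : ‖fderiv ℝ e (u θ • dir θ)‖ ≤ E₁) (hE₂ : ‖fderiv ℝ (fderiv ℝ e) (u θ • dir θ)‖ ≤ E₂)
    (hE₃ : ‖fderiv ℝ (fderiv ℝ (fderiv ℝ e)) (u θ • dir θ)‖ ≤ E₃)
    (hΔ₁ : ‖fderiv ℝ e' (v θ • dir θ) - fderiv ℝ e (u θ • dir θ)‖ ≤ Δ₁)
    (hΔ₂ : ‖fderiv ℝ (fderiv ℝ e') (v θ • dir θ) - fderiv ℝ (fderiv ℝ e) (u θ • dir θ)‖ ≤ Δ₂)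
    (hΔ₃ : ‖fderiv ℝ (fderiv ℝ (fderiv ℝ e')) (v θ • dir θ) - fderiv ℝ (fderiv ℝ (fderiv ℝ e)) (u θ • dir θ)‖ ≤ Δ₃)
    (hU₀ : |u θ| ≤ U₀) (hU₀' : |v θ| ≤ U₀) (hR₁ : |deriv u θ| ≤ R₁) (hR₁' : |deriv v θ| ≤ R₁)
    (hR₂ : |deriv (deriv u) θ| ≤ R₂) (hR₂' : |deriv (deriv v) θ| ≤ R₂) (hR₃ : |deriv (deriv (deriv u)) θ| ≤ R₃)
    (hW₀ : |v θ - u θ| ≤ W₀) (hW₁ : |deriv v θ - deriv u θ| ≤ W₁) (hW₂ : |deriv (deriv v) θ - deriv (deriv u) θ| ≤ W₂) :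
    |deriv (deriv (deriv v)) θ - deriv (deriv (deriv u)) θ| ≤
      (Δ₃ * (R₁ + U₀) ^ 3 + 3 * E₃ * (W₁ + W₀) * (R₁ + U₀) ^ 2 +
        3 * (Δ₂ * (R₁ + U₀) * (R₂ + 2 * R₁ + U₀) + E₂ * ((W₂ + 2 * W₁ + W₀) * (R₁ + U₀) + (R₂ + 2 * R₁ + U₀) * (W₁ + W₀))) +
        Δ₁ * (3 * R₂ + 3 * R₁ + U₀) + E₁ * (3 * W₂ + 3 * W₁ + W₀) + R₃ * Δ₁) / ρ₀ := by
  have hid := level_chain_three (k₀ := fun t => u t • dir t) (he.of_le (by norm_num)) hlev (hasDerivAt_polar_zero hu)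
    (hasDerivAt_polar_one hu) (hasDerivAt_polar_two hu) θ
  have hid' := level_chain_three (k₀ := fun t => v t • dir t) (he'.of_le (by norm_num)) hlev' (hasDerivAt_polar_zero hv)
    (hasDerivAt_polar_one hv) (hasDerivAt_polar_two hv) θ
  set A₁ := fderiv ℝ e (u θ • dir θ) with hA₁
  set Ã₁ := fderiv ℝ e' (v θ • dir θ) with hÃ₁
  set A₂ := fderiv ℝ (fderiv ℝ e) (u θ • dir θ) with hA₂
  set Ã₂ := fderiv ℝ (fderiv ℝ e') (v θ • dir θ) with hÃ₂
  set A₃ := fderiv ℝ (fderiv ℝ (fderiv ℝ e)) (u θ • dir θ) with hA₃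
  set Ã₃ := fderiv ℝ (fderiv ℝ (fderiv ℝ e')) (v θ • dir θ) with hÃ₃
  set d₀ := dir θ with hd₀
  set d₁ := dir (θ + π / 2) with hd₁
  clear_value A₁ Ã₁ A₂ Ã₂ A₃ Ã₃
  have hfc : ∀ a b : ℝ, ‖a • d₀ + b • d₁‖ ≤ |a| + |b| := fun a b => by rw [hd₀, hd₁]; exact norm_frame_comb_le a b θ
  clear_value d₀ d₁
  have hnd₀ : ‖d₀‖ ≤ 1 := hd₀ ▸ norm_dir_le_one _
  -- nonnegativity
  have hU0 : 0 ≤ U₀ := (abs_nonneg _).trans hU₀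
  have hR10 : 0 ≤ R₁ := (abs_nonneg _).trans hR₁
  have hR20 : 0 ≤ R₂ := (abs_nonneg _).trans hR₂
  have hW00 : 0 ≤ W₀ := (abs_nonneg _).trans hW₀
  have hW10 : 0 ≤ W₁ := (abs_nonneg _).trans hW₁
  have hW20 : 0 ≤ W₂ := (abs_nonneg _).trans hW₂
  -- tower vectors, their sizes and differences
  have hK₁ : ‖deriv u θ • d₀ + u θ • d₁‖ ≤ R₁ + U₀ := (hfc _ _).trans (by linarith)
  have hK₁' : ‖deriv v θ • d₀ + v θ • d₁‖ ≤ R₁ + U₀ := (hfc _ _).trans (by linarith)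
  have h2u : |2 * deriv u θ| ≤ 2 * R₁ := by rw [abs_mul, abs_two]; linarith
  have h2v : |2 * deriv v θ| ≤ 2 * R₁ := by rw [abs_mul, abs_two]; linarith
  have hK₂ : ‖(deriv (deriv u) θ - u θ) • d₀ + (2 * deriv u θ) • d₁‖ ≤ R₂ + 2 * R₁ + U₀ :=
    (hfc _ _).trans (by linarith [abs_sub (deriv (deriv u) θ) (u θ)])
  have hK₂' : ‖(deriv (deriv v) θ - v θ) • d₀ + (2 * deriv v θ) • d₁‖ ≤ R₂ + 2 * R₁ + U₀ :=
    (hfc _ _).trans (by linarith [abs_sub (deriv (deriv v) θ) (v θ)])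
  have hδ₁ : ‖(deriv v θ • d₀ + v θ • d₁) - (deriv u θ • d₀ + u θ • d₁)‖ ≤ W₁ + W₀ := by
    have e1 : (deriv v θ • d₀ + v θ • d₁) - (deriv u θ • d₀ + u θ • d₁) = (deriv v θ - deriv u θ) • d₀ + (v θ - u θ) • d₁ := by
      rw [sub_smul, sub_smul]; abel
    rw [e1]; exact (hfc _ _).trans (by linarith)
  have hδ₂ : ‖((deriv (deriv v) θ - v θ) • d₀ + (2 * deriv v θ) • d₁) - ((deriv (deriv u) θ - u θ) • d₀ + (2 * deriv u θ) • d₁)‖ ≤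
      W₂ + 2 * W₁ + W₀ := by
    have e1 : ((deriv (deriv v) θ - v θ) • d₀ + (2 * deriv v θ) • d₁) - ((deriv (deriv u) θ - u θ) • d₀ + (2 * deriv u θ) • d₁) =
        ((deriv (deriv v) θ - deriv (deriv u) θ) - (v θ - u θ)) • d₀ + (2 * (deriv v θ - deriv u θ)) • d₁ := by
      simp only [sub_smul, mul_sub]; abel
    rw [e1]
    refine (hfc _ _).trans ?_
    rw [abs_mul, abs_two]
    linarith [abs_sub (deriv (deriv v) θ - deriv (deriv u) θ) (v θ - u θ)]
  -- the remainders `r = (−3u′)•d₀ + (3u″ − u)•d₁`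
  have hL : ‖(-(3 * deriv v θ)) • d₀ + (3 * deriv (deriv v) θ - v θ) • d₁‖ ≤ 3 * R₂ + 3 * R₁ + U₀ := by
    refine (hfc _ _).trans ?_
    rw [abs_neg, abs_mul, show |(3 : ℝ)| = 3 by norm_num]
    have : |3 * deriv (deriv v) θ - v θ| ≤ 3 * R₂ + U₀ := by
      refine (abs_sub _ _).trans ?_; rw [abs_mul, show |(3 : ℝ)| = 3 by norm_num]; linarith
    linarith
  have hdL : ‖((-(3 * deriv v θ)) • d₀ + (3 * deriv (deriv v) θ - v θ) • d₁) -
      ((-(3 * deriv u θ)) • d₀ + (3 * deriv (deriv u) θ - u θ) • d₁)‖ ≤ 3 * W₂ + 3 * W₁ + W₀ := by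
    have e1 : ((-(3 * deriv v θ)) • d₀ + (3 * deriv (deriv v) θ - v θ) • d₁) -
        ((-(3 * deriv u θ)) • d₀ + (3 * deriv (deriv u) θ - u θ) • d₁) =
        (-(3 * (deriv v θ - deriv u θ))) • d₀ + ((3 * (deriv (deriv v) θ - deriv (deriv u) θ)) - (v θ - u θ)) • d₁ := by
      simp only [sub_smul, neg_smul, mul_sub]; abel
    rw [e1]
    refine (hfc _ _).trans ?_
    rw [abs_neg, abs_mul, show |(3 : ℝ)| = 3 by norm_num]
    have : |3 * (deriv (deriv v) θ - deriv (deriv u) θ) - (v θ - u θ)| ≤ 3 * W₂ + W₀ := by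
      refine (abs_sub _ _).trans ?_; rw [abs_mul, show |(3 : ℝ)| = 3 by norm_num]; linarith
    linarith
  have hv3 : (deriv (deriv (deriv u)) θ - 3 * deriv u θ) • d₀ + (3 * deriv (deriv u) θ - u θ) • d₁ =
      deriv (deriv (deriv u)) θ • d₀ + ((-(3 * deriv u θ)) • d₀ + (3 * deriv (deriv u) θ - u θ) • d₁) := by
    rw [sub_smul, neg_smul]; abel
  have hw3 : (deriv (deriv (deriv v)) θ - 3 * deriv v θ) • d₀ + (3 * deriv (deriv v) θ - v θ) • d₁ =
      deriv (deriv (deriv v)) θ • d₀ + ((-(3 * deriv v θ)) • d₀ + (3 * deriv (deriv v) θ - v θ) • d₁) := by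
    rw [sub_smul, neg_smul]; abel
  exact (abs_top_sub_top_le_of_level_three hid hid' hv3 hw3 hρ' hρ0 hnd₀ hE₁ hE₂ hE₃ hΔ₁ hΔ₂ hΔ₃ hK₁ hK₁' hK₂ hK₂' hδ₁ hδ₂ hL hdL
    hR₃).trans (le_of_eq (by ring))

end TwoPolar

end Summit.HubbardSuperconductivity.HubbardSuperconductivity.Theorems.PerturbedFermiCurve

end
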